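import Summits.BirchSwinnertonDyer.BirchSwinnertonDyer.Theorems.EisensteinPrimesFullDescentSplitting
import Mathlib.RingTheory.IntegralDomain
import HarnessLib

/-!
# Crux `GoodLatticeBDPValue` (stmt-BirchSwinnertonDyer-19032), line `halves`, road R5 / AN-5 (the `5 ≤ p` twin of
# Theorem T′) — brick HS-1: the ABSTRACT SPLITTING LEMMA at an arbitrary odd prime `p`
# (a hand-made `H¹` in degree one, modulo a stable subgroup, with Herbrand's input in Mazur's equivariant shape)

Width seat bsd-line-x1-p1-w7 (gen 7). HONEST FRAMING (cell `bsd-eis`, run/shared/lean/pub/bsd-eis/): TOOL THEOREM ONLY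
(no `def`, no named fact, no `sorry`); pure group theory — nothing about a curve, a number field, a summit statement,
Keller–Yin Thm. 2.2.2 or crux 2 is proved here; 0 stubs / cells / labels move.

WHY. The line `halves` (v24/v25) consumes the composed-print name `KellerYin2024.thm222_anacong_goodLattice_of_five_le`
at `5 ≤ p` and 3a-A `…_of_fullDescentDatum` at `p = 3` (fed by the kernel theorem T′ =
`GoodLatticeBDPValueFullDescentStub.stub_fullDescentAtThreeOfRed`, p658450). Road R5 (HOME STATUS 2026-08-28 21:34Z, seat w7 g7)
proves the `5 ≤ p` twin T‴ of T′ (a full-descent datum at every good Eisenstein `p ≥ 5` under the good-lattice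
normalisation; Ribet–Yoo necessity for `E/ℚ`) along w3 gen 4's elementary road
(`HOME/line-x1-p1-w3-g4/AN3-StubB-elementary-road.md`, Case ω, steps A1–A5 at level `p`/`p²`), which makes `_of_five_le`
a corollary of 3a-A. Step A2 needs an extension `0 → 𝟙 → M → ω → 0` of `Γ_ℚ`-modules (here `M = p⁻¹C/C`), inertia-trivial
at every `ℓ ≠ p` and split at `D_p`, to SPLIT. Its obstruction is a class in `H¹(Γ_ℚ, 𝔽_p(ω⁻¹))`; restricted to
`K = ker ω = Γ_{ℚ(ζ_p)}` it is a homomorphism `η : K → ℤ/p`, `ω⁻¹`-EQUIVARIANT under conjugation by `Γ_ℚ`, killed by every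
inertia group and locally constant — and «such an `η` vanishes» is, for every odd prime `p`, Herbrand's theorem
`A(ω^{p−2}) = 0` (`p ∤ B₂ = 1/6`), IN THE TREE as `Literature.NumberTheory.EllipticCurves.Mazur1977_herbrand`
(Mazur 1977 III §5 (R3); `MazurTorsionHerbrandProofs.lean`). This file is w3 gen 4's abstract lemma
`FullDescentSplitting.exists_stable_complement_mod` (the `p = 3` brick F5, `ℤ/3`, hypothesis `hGK` without equivariance —
`h(ℚ(ζ₃)) = 1`; its `mk_smul_eq_of_mk_eq` is reused) rewritten for an ARBITRARY prime `p` with the arithmetic input `hGK` in EXACTLY the shape of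
`Mazur1977_herbrand` (a map `b : G → ℤ/p` additive on `ker ω`, `ω⁻¹`-equivariant, killed by the given subgroups ⟹ `b = 0`
on `ker ω`), so that the sequel brick HS-2 (`…FullDescentHerbrandSplitting`) discharges it by that theorem.

* `exists_stable_complement_mod` — THE LEMMA: a group `G` acting on an abelian group `M`, everything read modulo a
  `G`-stable subgroup `C`; (i) `σP ≡ P`, `σQ ≡ ω(σ)Q + c(σ)P (mod C)` with `P, Q` independent of order `p` mod `C`
  (`ω : G →* (ℤ/p)ˣ`, `ω(σ)` acting through its representative in `ℕ`); (ii) a family of subgroups `I j` fixing `Q` mod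
  `C`; (iii) a family of subgroups `D k` each stabilising a subgroup `Λ_k` containing a representative of some `Q + aP` and
  meeting `ℤ•P + C` only in `C`; (iv) `hGK` (Mazur's shape) — then there is `a : ℤ` with `σ(Q + aP) ≡ ω(σ)(Q + aP)
  (mod C)` for ALL `σ ∈ G`, i.e. `ℤ•(Q + aP) + C` is a `G`-stable complement of `ℤ•P + C` over `C`.

The coboundary step is done WITHOUT a generator of `ω(G)`: since `ω(G) ≤ (ℤ/p)ˣ` is commutative, the cocycle `c̄`
(vanishing on `ker ω`) satisfies `(ω(τ) − 1)c̄(σ) = (ω(σ) − 1)c̄(τ)`, whence `c̄(σ) = (ω(σ) − 1)·a` with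
`a = c̄(τ₀)/(ω(τ₀) − 1)` for any `τ₀ ∉ ker ω` (Serre, *Local Fields* VII §2: `H¹` of a group of order prime to `p` with
values in an `𝔽_p`-module vanishes — here by hand).

References: [SerreLocalFields1979] J.-P. Serre, *Local Fields*, GTM 67, Ch. VII §§1–2; [Mazur1977] B. Mazur, *Modular
curves and the Eisenstein ideal*, Publ. Math. IHÉS 47 (1977), Ch. I §2 Prop. (2.8)–Cor. (2.9), Ch. III §5 p. 158 (the
intended instance of `hGK`); [Washington1997] L. C. Washington, *Introduction to Cyclotomic Fields*, GTM 83, §6.3 Thm. 6.17.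
-/

set_option autoImplicit false
set_option linter.dupNamespace false

namespace Summit.BirchSwinnertonDyer.BirchSwinnertonDyer.Theorems.FullDescentSplittingPrime

open Summit.BirchSwinnertonDyer.BirchSwinnertonDyer.Theorems.FullDescentTateAlgebra (smul_zsmul_comm)
open Summit.BirchSwinnertonDyer.BirchSwinnertonDyer.Theorems.FullDescentSplitting (mk_smul_eq_of_mk_eq)

variable {G M : Type*} [Group G] [AddCommGroup M] [DistribMulAction G M]

/-- The representative in `ℤ` of `ω(σ) ∈ (ℤ/p)ˣ` reduces to `ω(σ)` in `ℤ/p`. [folklore] -/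
theorem intCast_val_units {p : ℕ} (u : (ZMod p)ˣ) [NeZero p] :
    ((((u : ZMod p).val : ℕ) : ℤ) : ZMod p) = (u : ZMod p) := by
  rw [Int.cast_natCast, ZMod.natCast_zmod_val]

/-- **The abstract splitting lemma at a prime `p`** (memo A2 at level `p`; Serre, *Local Fields* VII §§1–2 by hand).
See the module docstring: an extension of the `ω`-line by the trivial line, read modulo a `G`-stable subgroup `C`,
splits as soon as its cocycle — read on `ker ω` as an `ω⁻¹`-equivariant map `b : G → ℤ/p`, additive on `ker ω` —
is killed by the given subgroups (`hI`: they fix `Q`; `hD`: they stabilise a complement) and every such map vanishes on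
`ker ω` (`hGK`, the shape of `Literature.NumberTheory.EllipticCurves.Mazur1977_herbrand`). The conclusion exhibits the
stable complement `ℤ•(Q + aP) + C`. [cite: SerreLocalFields1979, Ch. VII §1–§2]
[cite: Mazur1977, Ch. I §2 Prop. (2.8)–Cor. (2.9) and Ch. III §5 p. 158] -/
theorem exists_stable_complement_mod {p : ℕ} [hp : Fact p.Prime]
    {C : AddSubgroup M} (hC : ∀ σ : G, ∀ x ∈ C, σ • x ∈ C)
    {P Q : M} (ω : G →* (ZMod p)ˣ) {c : G → ℤ}
    (hP : ∀ σ : G, σ • P - P ∈ C)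
    (hQ : ∀ σ : G, σ • Q - ((((ω σ : (ZMod p)ˣ) : ZMod p).val : ℤ) • Q + c σ • P) ∈ C)
    (hind : ∀ a b : ℤ, a • P + b • Q ∈ C ↔ (p : ℤ) ∣ a ∧ (p : ℤ) ∣ b)
    {ιI ιD : Type*} (I : ιI → Subgroup G) (D : ιD → Subgroup G)
    (hI : ∀ j, ∀ σ ∈ I j, σ • Q - Q ∈ C)
    (hD : ∀ k, ∃ Λ : AddSubgroup M, (∀ σ ∈ D k, ∀ x ∈ Λ, σ • x ∈ Λ) ∧
        (∃ x ∈ Λ, ∃ a : ℤ, x - (Q + a • P) ∈ C) ∧ (∀ x ∈ Λ, ∀ b : ℤ, x - b • P ∈ C → (p : ℤ) ∣ b))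
    (hGK : ∀ b : G → ZMod p,
        (∀ σ τ : G, ω σ = 1 → ω τ = 1 → b (σ * τ) = b σ + b τ) →
        (∀ g σ : G, ω σ = 1 → b (g * σ * g⁻¹) = (((ω g)⁻¹ : (ZMod p)ˣ) : ZMod p) * b σ) →
        (∀ j, ∀ σ ∈ I j, ω σ = 1 → b σ = 0) →
        (∀ k, ∀ σ ∈ D k, ω σ = 1 → b σ = 0) →
        ∀ σ : G, ω σ = 1 → b σ = 0) :
    ∃ a : ℤ, ∀ σ : G,
      σ • (Q + a • P) - (((ω σ : (ZMod p)ˣ) : ZMod p).val : ℤ) • (Q + a • P) ∈ C := by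
  haveI : NeZero p := ⟨hp.out.ne_zero⟩
  haveI : Fact (1 < p) := ⟨hp.out.one_lt⟩
  -- Notation: `e σ ∈ ℤ` the representative of `ω σ`, `ē σ ∈ ℤ/p` its class, `π : M → M ⧸ C`.
  set e : G → ℤ := fun σ ↦ ((((ω σ : (ZMod p)ˣ) : ZMod p).val : ℕ) : ℤ) with he_def
  have he : ∀ σ : G, ((e σ : ℤ) : ZMod p) = ((ω σ : (ZMod p)ˣ) : ZMod p) := fun σ ↦ intCast_val_units (ω σ)
  have he1 : ∀ σ : G, ω σ = 1 → e σ = 1 := fun σ hσ ↦ by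
    simp only [he_def, hσ, Units.val_one, ZMod.val_one, Nat.cast_one]
  have hdvd_iff : ∀ z : ℤ, ((z : ZMod p) = 0) ↔ (p : ℤ) ∣ z := fun z ↦ ZMod.intCast_zmod_eq_zero_iff_dvd z p
  have hπP : ∀ σ : G, ((σ • P : M) : M ⧸ C) = (P : M ⧸ C) := fun σ ↦
    (QuotientAddGroup.eq_iff_sub_mem).mpr (hP σ)
  have hπQ : ∀ σ : G, ((σ • Q : M) : M ⧸ C) = e σ • (Q : M ⧸ C) + c σ • (P : M ⧸ C) := fun σ ↦ by
    have h := (QuotientAddGroup.eq_iff_sub_mem).mpr (hQ σ)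
    rw [h]; simp [he_def]
  have hind' : ∀ a b : ℤ, a • (P : M ⧸ C) + b • (Q : M ⧸ C) = 0 ↔ (p : ℤ) ∣ a ∧ (p : ℤ) ∣ b := by
    intro a b
    rw [← hind, ← QuotientAddGroup.eq_zero_iff]
    simp
  have hpP : (p : ℤ) • P ∈ C := by
    have h := (hind p 0).mpr ⟨dvd_rfl, dvd_zero _⟩
    simpa using h
  -- (1) the cocycle identity `c(στ) ≡ e(τ) c(σ) + c(τ) (mod p)`
  have hcoc : ∀ σ τ : G, (p : ℤ) ∣ c (σ * τ) - (e τ * c σ + c τ) := by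
    intro σ τ
    -- `π((στ)Q)` computed directly and through `σ(τQ)`
    have h1 := hπQ (σ * τ)
    have h2 : (((σ * τ) • Q : M) : M ⧸ C) =
        (e σ * e τ) • (Q : M ⧸ C) + (e τ * c σ + c τ) • (P : M ⧸ C) := by
      have hτQ : ((τ • Q : M) : M ⧸ C) = ((((e τ) • Q + c τ • P : M)) : M ⧸ C) := by rw [hπQ τ]; simp
      rw [mul_smul, mk_smul_eq_of_mk_eq hC σ hτQ, smul_add, smul_zsmul_comm, smul_zsmul_comm,
        QuotientAddGroup.mk_add, QuotientAddGroup.mk_zsmul, QuotientAddGroup.mk_zsmul, hπQ σ, hπP σ]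
      module
    rw [h1] at h2
    -- compare coefficients
    have hdiff : (c (σ * τ) - (e τ * c σ + c τ)) • (P : M ⧸ C) + (e (σ * τ) - e σ * e τ) • (Q : M ⧸ C)
        = 0 := by
      have e0 := sub_eq_zero.mpr h2
      rw [← e0]; module
    exact ((hind' _ _).mp hdiff).1
  -- `c(1) ≡ 0`
  have hc1 : (p : ℤ) ∣ c 1 := by
    have h := hπQ 1
    rw [one_smul, he1 1 (map_one ω), one_smul] at h
    have h' : c 1 • (P : M ⧸ C) = 0 := by
      have := h.symm
      rwa [add_eq_left] at this
    have hdiff : (c 1) • (P : M ⧸ C) + (0 : ℤ) • (Q : M ⧸ C) = 0 := by simpa using h'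
    exact ((hind' _ _).mp hdiff).1
  -- (2) the map `b = c mod p : G → ℤ/p` and its cocycle identity in `ℤ/p`
  set b : G → ZMod p := fun σ ↦ ((c σ : ℤ) : ZMod p) with hb_def
  have hbcoc : ∀ σ τ : G, b (σ * τ) = ((ω τ : (ZMod p)ˣ) : ZMod p) * b σ + b τ := by
    intro σ τ
    have h := hcoc σ τ
    rw [← hdvd_iff, Int.cast_sub, sub_eq_zero, Int.cast_add, Int.cast_mul, he τ] at h
    exact h
  have hb1 : b 1 = 0 := (hdvd_iff (c 1)).mpr hc1
  have hbinv : ∀ g : G, b g⁻¹ = -((((ω g)⁻¹ : (ZMod p)ˣ) : ZMod p) * b g) := by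
    intro g
    have h := hbcoc g g⁻¹
    rw [mul_inv_cancel, hb1, map_inv] at h
    linear_combination -h
  -- (3) Mazur's hypotheses for `b`
  have hbmul : ∀ σ τ : G, ω σ = 1 → ω τ = 1 → b (σ * τ) = b σ + b τ := by
    intro σ τ _ hτ
    rw [hbcoc, hτ, Units.val_one, one_mul]
  have hbconj : ∀ g σ : G, ω σ = 1 → b (g * σ * g⁻¹) = (((ω g)⁻¹ : (ZMod p)ˣ) : ZMod p) * b σ := by
    intro g σ hσ
    rw [hbcoc (g * σ) g⁻¹, hbcoc g σ, hσ, Units.val_one, one_mul, hbinv g, map_inv]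
    ring
  have hbI : ∀ j, ∀ σ ∈ I j, ω σ = 1 → b σ = 0 := by
    intro j σ hσ hσ1
    rw [hb_def, hdvd_iff]
    have h := hπQ σ
    rw [he1 σ hσ1, one_smul, (QuotientAddGroup.eq_iff_sub_mem).mpr (hI j _ hσ)] at h
    have hdiff : (c σ) • (P : M ⧸ C) + (0 : ℤ) • (Q : M ⧸ C) = 0 := by
      have e0 := sub_eq_zero.mpr h
      rw [← neg_eq_zero, ← e0]; module
    exact ((hind' _ _).mp hdiff).1
  have hbD : ∀ k, ∀ σ ∈ D k, ω σ = 1 → b σ = 0 := by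
    intro k σ hσ hσ1
    rw [hb_def, hdvd_iff]
    obtain ⟨Λ, hΛst, ⟨x, hxΛ, a, hxa⟩, hΛP⟩ := hD k
    -- `σ x - x ≡ c(σ) P (mod C)` lies in `Λ`
    have hπx : (x : M ⧸ C) = ((Q + a • P : M) : M ⧸ C) := (QuotientAddGroup.eq_iff_sub_mem).mpr hxa
    have hσx : (σ • x : M) - x - c σ • P ∈ C := by
      rw [← QuotientAddGroup.eq_zero_iff, QuotientAddGroup.mk_sub, QuotientAddGroup.mk_sub,
        mk_smul_eq_of_mk_eq hC σ hπx, hπx, smul_add, smul_zsmul_comm, QuotientAddGroup.mk_add,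
        QuotientAddGroup.mk_add, QuotientAddGroup.mk_zsmul, QuotientAddGroup.mk_zsmul,
        QuotientAddGroup.mk_zsmul, hπQ, hπP, he1 σ hσ1]
      module
    have hmem : σ • x - x ∈ Λ := Λ.sub_mem (hΛst _ hσ x hxΛ) hxΛ
    exact hΛP _ hmem (c σ) hσx
  -- (4) the arithmetic input: `b = 0` on `ker ω`
  have hbK : ∀ σ : G, ω σ = 1 → b σ = 0 := hGK b hbmul hbconj hbI hbD
  -- (5) the coboundary: `(ω τ - 1) b σ = (ω σ - 1) b τ` (commutator in `ker ω`), hence `b σ = (ω σ - 1) a`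
  have hsym : ∀ σ τ : G, (((ω τ : (ZMod p)ˣ) : ZMod p) - 1) * b σ = (((ω σ : (ZMod p)ˣ) : ZMod p) - 1) * b τ := by
    intro σ τ
    set k : G := (τ * σ)⁻¹ * (σ * τ) with hk
    have hk1 : ω k = 1 := by
      rw [hk, map_mul, map_inv, map_mul, map_mul, mul_comm (ω τ) (ω σ), inv_mul_cancel]
    have hστ : σ * τ = (τ * σ) * k := by rw [hk]; group
    have h1 : b (σ * τ) = b (τ * σ) := by
      rw [hστ, hbcoc (τ * σ) k, hk1, Units.val_one, one_mul, hbK k hk1, add_zero]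
    rw [hbcoc σ τ, hbcoc τ σ] at h1
    linear_combination h1
  have hcob : ∃ a : ℤ, ∀ σ : G, b σ = (((ω σ : (ZMod p)ˣ) : ZMod p) - 1) * (a : ZMod p) := by
    by_cases hex : ∃ τ : G, ω τ ≠ 1
    · obtain ⟨τ, hτ⟩ := hex
      have hτ' : (((ω τ : (ZMod p)ˣ) : ZMod p) - 1) ≠ 0 := by
        rw [sub_ne_zero]
        exact fun h ↦ hτ (Units.val_eq_one.mp h)
      set a₀ : ZMod p := b τ * (((ω τ : (ZMod p)ˣ) : ZMod p) - 1)⁻¹ with ha₀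
      refine ⟨((a₀.val : ℕ) : ℤ), fun σ ↦ ?_⟩
      rw [Int.cast_natCast, ZMod.natCast_zmod_val, ha₀]
      have h := hsym σ τ
      field_simp
      linear_combination h
    · push Not at hex
      exact ⟨0, fun σ ↦ by rw [hbK σ (hex σ), Int.cast_zero, mul_zero]⟩
  -- (6) conclusion
  obtain ⟨a, ha⟩ := hcob
  refine ⟨a, fun σ ↦ ?_⟩
  have hmod : (p : ℤ) ∣ c σ - (e σ - 1) * a := by
    rw [← hdvd_iff, Int.cast_sub, Int.cast_mul, Int.cast_sub, he σ, Int.cast_one, sub_eq_zero]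
    exact ha σ
  obtain ⟨m, hm⟩ := hmod
  show σ • (Q + a • P) - e σ • (Q + a • P) ∈ C
  rw [← QuotientAddGroup.eq_zero_iff, smul_add, smul_zsmul_comm, QuotientAddGroup.mk_sub,
    QuotientAddGroup.mk_add, QuotientAddGroup.mk_zsmul, QuotientAddGroup.mk_zsmul, QuotientAddGroup.mk_add,
    QuotientAddGroup.mk_zsmul, hπQ σ, hπP σ]
  have hmP : ((p * m) • P : M) ∈ C := by rw [mul_comm, mul_smul]; exact C.zsmul_mem hpP m
  have hπmP : ((p * m : ℤ) • (P : M ⧸ C)) = 0 := by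
    rw [← QuotientAddGroup.eq_zero_iff] at hmP
    simpa using hmP
  have e0 : e σ • (Q : M ⧸ C) + c σ • (P : M ⧸ C) + a • (P : M ⧸ C) -
      e σ • ((Q : M ⧸ C) + a • (P : M ⧸ C)) =
      (c σ - (e σ - 1) * a) • (P : M ⧸ C) := by module
  rw [e0, hm, hπmP]

end Summit.BirchSwinnertonDyer.BirchSwinnertonDyer.Theorems.FullDescentSplittingPrime
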